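import Mathlib.Algebra.MvPolynomial.Basic
import Mathlib.RingTheory.Ideal.Operations
import Mathlib.RingTheory.Ideal.Maps
import Mathlib.Algebra.Group.Pointwise.Finset.Basic
import HarnessLib

/-!
# [OURS · L1 W3.6 / K3.6 specimen (B)] The cut of specimen (B) in `𝔸⁴`: symbolic powers of `J = (w, xy, yz, zx) ⊂ k[x,y,z,w]`
# (three concurrent lines in the hyperplane `w = 0`) — `xyz ∈ J^{(2)} ∖ J²` (ord-pow FAILS) and `(J^{(2)})^m = J^{(2m)}`
# (VERONESE STABILITY AT LEVEL 2 HOLDS); ring-level certificate, self-contained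

Cell `res-hironaka`, rung L of LADDER-RESOLUTION, slot W3.6 «ORD-POW CUT» / kill test K3.6 (RESCUE-SEED v0.6.3 §1 W3.6), specimen
(B): `Z = 𝔸⁴ = Spec k[x,y,z,w]`, `E_B = ((w²) + (xy,yz,zx)^M·𝒪, 2)`, whose singular locus / predicted `Σ̄_max` is the union `C` of the
three coordinate axes of the hyperplane `w = 0`, with radical ideal `J = (w, xy, yz, zx)` (minimal primes `(w,y,z)`, `(w,x,z)`,
`(w,x,y)`). res-adj-3 GAP-AMEND R12 12a (2026-08-27T01:1xZ): «score (B) ALIVE-for-the-residual iff D_{2k} = D_2^k certifies»;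
res-type-010 K3.6 AMENDMENT 1 01:04:14Z «(B) predicted level-2 core focus». HOST (custody, no new route):
`Theses.MarkedTransfer.HypersurfaceOrderReduction` (stmt-ResolutionOfSingularities-16155), `--supports … --as helper`. Companion of
`MarkedTransferCampaignW36ThreeLines.lean` (the `k[x,y,z]` core, p482973). Author seat: res-type-009 (RESERVE), STATUS 2026-08-27T01:31:42Z.

HONEST FRAMING. Elementary commutative algebra about monomial ideals in `k[x,y,z,w] = k[X 0, X 1, X 2, X 3]` over a commutative
ring `k`; NOTHING here is a statement of H. Hironaka's manuscript (2017, [Hironaka2017]) and no candidate statement of it is used as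
a premise. With `J^{(n)} := (w,y,z)^n ∩ (w,x,z)^n ∩ (w,x,y)^n` (intersection of the `n`-th powers of the three minimal primes):
* `mem_symbPow_iff` — `f ∈ J^{(n)}` iff every support exponent `d` has `d_w+d_y+d_z ≥ n`, `d_w+d_x+d_z ≥ n`, `d_w+d_x+d_y ≥ n`;
* `symbPow_one` — `J^{(1)} = J`; `symbPow_mul_le` / `symbPow_pow_le` (graded family);
* companion file `MarkedTransferCampaignW36ThreeLinesA4Veronese.lean`: `xyz ∈ J^{(2)} ∖ J²` («OrdPowAlong C» FAILS for this cut) and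
  **`(J^{(2)})^m = J^{(2m)}`** (VERONESE STABILITY AT LEVEL `2`, the hypothesis shape of `Lib/CoreFocusVeronese.stableAt_of_veronese`
  with `b₀ = 2`, at the ring level).
The SHEAF-level identification `diffPower C b = J^{(b)}·𝒪_{𝔸⁴}` and `StableAt E_B C 2` are NOT claimed here (res-type-010's
side per res-adj-3). AI-produced kernel evidence, weaker than expert review.
-/

noncomputable section

set_option linter.dupNamespace false -- mandated namespace of this single-conjunct summit

namespace Summit.ResolutionOfSingularities.ResolutionOfSingularities.Theorems

namespace CampaignW36

namespace ThreeLinesA4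

open MvPolynomial
open scoped Pointwise

variable {k : Type*} [CommRing k]

/-- The polynomial ring `k[x,y,z,w] = k[X 0, X 1, X 2, X 3]` of specimen (B) (plumbing abbreviation). -/
abbrev R (k : Type*) [CommRing k] : Type _ := MvPolynomial (Fin 4) k

/-! ## Weight ideals (as in the `k[x,y,z]` file, for four variables) -/

/-- **The weight ideal `W_w(n)`** of an additive weight `w`: all polynomials every monomial of which has `w`-weight `≥ n`
(plumbing definition). -/
def wIdeal (w : (Fin 4 →₀ ℕ) →+ ℕ) (n : ℕ) : Ideal (R k) where
  carrier := {f | ∀ d ∈ f.support, n ≤ w d}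
  zero_mem' := by
    intro d hd
    simp at hd
  add_mem' := by
    classical
    intro f g hf hg d hd
    rcases Finset.mem_union.mp (support_add hd) with h | h
    · exact hf d h
    · exact hg d h
  smul_mem' := by
    classical
    intro c f hf d hd
    rw [smul_eq_mul] at hd
    obtain ⟨a, ha, b, hb, rfl⟩ := Finset.mem_add.mp (support_mul c f hd)
    rw [map_add]
    exact le_add_left (hf b hb)

/-- Membership in a weight ideal (definitional unfolding). -/
theorem mem_wIdeal_iff {w : (Fin 4 →₀ ℕ) →+ ℕ} {n : ℕ} {f : R k} :
    f ∈ wIdeal w n ↔ ∀ d ∈ f.support, n ≤ w d := Iff.rfl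

/-- `W_w(a) · W_w(b) ⊆ W_w(a+b)`. -/
theorem wIdeal_mul_le (w : (Fin 4 →₀ ℕ) →+ ℕ) (a b : ℕ) :
    wIdeal (k := k) w a * wIdeal w b ≤ wIdeal w (a + b) := by
  classical
  rw [Ideal.mul_le]
  intro f hf g hg d hd
  obtain ⟨u, hu, v, hv, rfl⟩ := Finset.mem_add.mp (support_mul f g hd)
  rw [map_add]
  exact add_le_add (hf u hu) (hg v hv)

/-- `W_w(a)^m ⊆ W_w(m·a)`. -/
theorem wIdeal_pow_le (w : (Fin 4 →₀ ℕ) →+ ℕ) (a m : ℕ) :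
    wIdeal (k := k) w a ^ m ≤ wIdeal w (m * a) := by
  induction m with
  | zero =>
    intro f _ d _
    simp
  | succ m ih =>
    rw [pow_succ, Nat.succ_mul]
    exact le_trans (Ideal.mul_mono_left ih) (wIdeal_mul_le w (m * a) a)

/-- A monomial lies in `W_w(n)` as soon as its weight is `≥ n`. -/
theorem monomial_mem_wIdeal {w : (Fin 4 →₀ ℕ) →+ ℕ} {n : ℕ} {d : Fin 4 →₀ ℕ} (h : n ≤ w d) (c : k) :
    monomial d c ∈ wIdeal w n := by
  classical
  intro e he
  rw [support_monomial] at he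
  split_ifs at he with hc
  · simp at he
  · rw [Finset.mem_singleton] at he
    subst he
    exact h

/-- A monomial with a non-zero coefficient lies in `W_w(n)` ONLY IF its weight is `≥ n`. -/
theorem le_of_monomial_mem_wIdeal {w : (Fin 4 →₀ ℕ) →+ ℕ} {n : ℕ} {d : Fin 4 →₀ ℕ} {c : k} (hc : c ≠ 0)
    (h : monomial d c ∈ wIdeal w n) : n ≤ w d := by
  classical
  refine h d ?_
  rw [support_monomial, if_neg hc]
  exact Finset.mem_singleton_self d

/-- An ideal contains `W_w(n)` as soon as it contains every monomial of weight `≥ n`. -/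
theorem wIdeal_le_of_monomial_mem {w : (Fin 4 →₀ ℕ) →+ ℕ} {n : ℕ} {J : Ideal (R k)}
    (h : ∀ d : Fin 4 →₀ ℕ, n ≤ w d → monomial d (1 : k) ∈ J) : wIdeal w n ≤ J := by
  intro f hf
  rw [as_sum f]
  refine Submodule.sum_mem _ fun d hd => ?_
  have h1 : monomial d (coeff d f) = C (coeff d f) * monomial d (1 : k) := by
    rw [C_mul_monomial, mul_one]
  rw [h1]
  exact Ideal.mul_mem_left _ _ (h d (hf d hd))

/-- Peeling a divisor off a monomial: `X^d = X^e · X^{d−e}` for `e ≤ d`. -/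
theorem monomial_eq_mul_of_le {e d : Fin 4 →₀ ℕ} (h : e ≤ d) :
    monomial d (1 : k) = monomial e 1 * monomial (d - e) 1 := by
  rw [monomial_mul, mul_one, add_tsub_cancel_of_le h]

/-! ## The primes `(X a, X b, X c)` of the three axes and their powers -/

/-- The additive weight `d ↦ d a + d b + d c`. -/
def tripleWeight (a b c : Fin 4) : (Fin 4 →₀ ℕ) →+ ℕ :=
  Finsupp.applyAddHom a + Finsupp.applyAddHom b + Finsupp.applyAddHom c

/-- `tripleWeight a b c d = d a + d b + d c`. -/
@[simp] theorem tripleWeight_apply (a b c : Fin 4) (d : Fin 4 →₀ ℕ) : tripleWeight a b c d = d a + d b + d c := rfl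

/-- The prime ideal `(X a, X b, X c)` of a coordinate axis of `𝔸⁴` (for `a, b, c` distinct). -/
def P (a b c : Fin 4) : Ideal (R k) := Ideal.span {X a, X b, X c}

/-- `(X a, X b, X c) ⊆ W_{abc}(1)`. -/
theorem P_le_wIdeal_one (a b c : Fin 4) : P (k := k) a b c ≤ wIdeal (tripleWeight a b c) 1 := by
  rw [P, Ideal.span_le]
  intro f hf
  simp only [Set.mem_insert_iff, Set.mem_singleton_iff] at hf
  rw [SetLike.mem_coe]
  rcases hf with rfl | rfl | rfl
  · have hX : (X a : R k) = monomial (Finsupp.single a 1) 1 := rfl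
    rw [hX]; exact monomial_mem_wIdeal (by simp only [tripleWeight_apply, Finsupp.single_eq_same]; omega) 1
  · have hX : (X b : R k) = monomial (Finsupp.single b 1) 1 := rfl
    rw [hX]; exact monomial_mem_wIdeal (by simp only [tripleWeight_apply, Finsupp.single_eq_same]; omega) 1
  · have hX : (X c : R k) = monomial (Finsupp.single c 1) 1 := rfl
    rw [hX]; exact monomial_mem_wIdeal (by simp only [tripleWeight_apply, Finsupp.single_eq_same]; omega) 1

/-- A monomial `X^d` with `d a + d b + d c ≥ n` lies in `(X a, X b, X c)^n` (`a, b, c` distinct). -/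
theorem monomial_mem_P_pow {a b c : Fin 4} (hab : a ≠ b) (hbc : b ≠ c) (hac : a ≠ c) {n : ℕ} {d : Fin 4 →₀ ℕ}
    (h : n ≤ d a + d b + d c) : monomial d (1 : k) ∈ P a b c ^ n := by
  classical
  set e : Fin 4 →₀ ℕ := Finsupp.single a (d a) + Finsupp.single b (d b) + Finsupp.single c (d c) with he
  have hle : e ≤ d := by
    intro l
    simp only [he, Finsupp.coe_add, Pi.add_apply, Finsupp.single_apply]
    by_cases h1 : a = l
    · subst h1
      have h2 : ¬ b = a := fun h => hab h.symm
      have h3 : ¬ c = a := fun h => hac h.symm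
      simp [h2, h3]
    · by_cases h2 : b = l
      · subst h2
        have h3 : ¬ c = b := fun h => hbc h.symm
        simp [h1, h3]
      · by_cases h3 : c = l
        · subst h3
          simp [h1, h2]
        · simp [h1, h2, h3]
  have hmon : monomial d (1 : k) = (X a ^ d a * X b ^ d b * X c ^ d c) * monomial (d - e) 1 := by
    rw [X_pow_eq_monomial, X_pow_eq_monomial, X_pow_eq_monomial, monomial_mul, monomial_mul, monomial_mul, mul_one, mul_one,
      mul_one, ← he, add_tsub_cancel_of_le hle]
  rw [hmon]
  refine Ideal.mul_mem_right _ _ ?_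
  have hXa : (X a : R k) ∈ P a b c := Ideal.subset_span (by simp)
  have hXb : (X b : R k) ∈ P a b c := Ideal.subset_span (by simp)
  have hXc : (X c : R k) ∈ P a b c := Ideal.subset_span (by simp)
  have h1 : X a ^ d a * X b ^ d b * X c ^ d c ∈ P (k := k) a b c ^ (d a + d b + d c) := by
    rw [pow_add, pow_add]
    exact Ideal.mul_mem_mul (Ideal.mul_mem_mul (Ideal.pow_mem_pow hXa _) (Ideal.pow_mem_pow hXb _))
      (Ideal.pow_mem_pow hXc _)
  exact Ideal.pow_le_pow_right h h1

/-- **`(X a, X b, X c)^n = W_{abc}(n)`** (`a, b, c` distinct): membership in the `n`-th power of the ideal of an axis is read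
off the support. -/
theorem P_pow_eq_wIdeal {a b c : Fin 4} (hab : a ≠ b) (hbc : b ≠ c) (hac : a ≠ c) (n : ℕ) :
    P (k := k) a b c ^ n = wIdeal (tripleWeight a b c) n := by
  refine le_antisymm ?_ (wIdeal_le_of_monomial_mem fun d hd => monomial_mem_P_pow hab hbc hac hd)
  calc P a b c ^ n ≤ wIdeal (tripleWeight a b c) 1 ^ n := Ideal.pow_right_mono (P_le_wIdeal_one a b c) n
    _ ≤ wIdeal (tripleWeight a b c) (n * 1) := wIdeal_pow_le _ 1 n
    _ = wIdeal (tripleWeight a b c) n := by rw [mul_one]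

/-! ## `J = (w, xy, yz, zx)` and its symbolic powers (`x = X 0`, `y = X 1`, `z = X 2`, `w = X 3`) -/

/-- **`J = (X₃, X₀X₁, X₁X₂, X₀X₂)`** — the radical ideal of the three coordinate axes of the hyperplane `X₃ = 0` in `𝔸⁴`. -/
def J : Ideal (R k) := Ideal.span {X 3, X 0 * X 1, X 1 * X 2, X 0 * X 2}

/-- **`J^{(n)} := (X₃,X₁,X₂)^n ∩ (X₃,X₀,X₂)^n ∩ (X₃,X₀,X₁)^n`** — the `n`-th symbolic power of `J` (intersection of the `n`-th
powers of its three minimal primes, the ideals of the `x`-, `y`- and `z`-axis). -/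
def symbPow (n : ℕ) : Ideal (R k) := P 3 1 2 ^ n ⊓ P 3 0 2 ^ n ⊓ P 3 0 1 ^ n

/-- **Monomial criterion**: `f ∈ J^{(n)}` iff every support exponent `d` has `d₃+d₁+d₂ ≥ n`, `d₃+d₀+d₂ ≥ n`, `d₃+d₀+d₁ ≥ n`. -/
theorem mem_symbPow_iff {n : ℕ} {f : R k} :
    f ∈ symbPow n ↔ ∀ d ∈ f.support, n ≤ d 3 + d 1 + d 2 ∧ n ≤ d 3 + d 0 + d 2 ∧ n ≤ d 3 + d 0 + d 1 := by
  simp only [symbPow, P_pow_eq_wIdeal (show (3 : Fin 4) ≠ 1 by decide) (show (1 : Fin 4) ≠ 2 by decide)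
    (show (3 : Fin 4) ≠ 2 by decide), P_pow_eq_wIdeal (show (3 : Fin 4) ≠ 0 by decide) (show (0 : Fin 4) ≠ 2 by decide)
    (show (3 : Fin 4) ≠ 2 by decide), P_pow_eq_wIdeal (show (3 : Fin 4) ≠ 0 by decide) (show (0 : Fin 4) ≠ 1 by decide)
    (show (3 : Fin 4) ≠ 1 by decide), Ideal.mem_inf, mem_wIdeal_iff, tripleWeight_apply]
  constructor
  · rintro ⟨⟨h1, h2⟩, h3⟩ d hd
    exact ⟨h1 d hd, h2 d hd, h3 d hd⟩
  · intro h
    exact ⟨⟨fun d hd => (h d hd).1, fun d hd => (h d hd).2.1⟩, fun d hd => (h d hd).2.2⟩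

/-- A monomial satisfying the three inequalities lies in `J^{(n)}`. -/
theorem monomial_mem_symbPow {n : ℕ} {d : Fin 4 →₀ ℕ} (h1 : n ≤ d 3 + d 1 + d 2) (h2 : n ≤ d 3 + d 0 + d 2)
    (h3 : n ≤ d 3 + d 0 + d 1) (c : k) : monomial d c ∈ symbPow n := by
  classical
  rw [mem_symbPow_iff]
  intro e he
  rw [support_monomial] at he
  split_ifs at he with hc
  · simp at he
  · rw [Finset.mem_singleton] at he
    subst he
    exact ⟨h1, h2, h3⟩

/-- `J^{(n)}` is contained in any ideal containing its monomials. -/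
theorem symbPow_le_of_monomial_mem {n : ℕ} {L : Ideal (R k)}
    (h : ∀ d : Fin 4 →₀ ℕ, n ≤ d 3 + d 1 + d 2 → n ≤ d 3 + d 0 + d 2 → n ≤ d 3 + d 0 + d 1 → monomial d (1 : k) ∈ L) :
    symbPow n ≤ L := by
  intro f hf
  rw [mem_symbPow_iff] at hf
  rw [as_sum f]
  refine Submodule.sum_mem _ fun d hd => ?_
  have h1 : monomial d (coeff d f) = C (coeff d f) * monomial d (1 : k) := by
    rw [C_mul_monomial, mul_one]
  rw [h1]
  obtain ⟨a, b, c⟩ := hf d hd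
  exact Ideal.mul_mem_left _ _ (h d a b c)

/-- `J^{(a)} · J^{(b)} ⊆ J^{(a+b)}`. -/
theorem symbPow_mul_le (a b : ℕ) : symbPow (k := k) a * symbPow b ≤ symbPow (a + b) := by
  classical
  rw [Ideal.mul_le]
  intro f hf g hg
  rw [mem_symbPow_iff] at hf hg ⊢
  intro d hd
  obtain ⟨u, hu, v, hv, rfl⟩ := Finset.mem_add.mp (support_mul f g hd)
  obtain ⟨a1, a2, a3⟩ := hf u hu
  obtain ⟨b1, b2, b3⟩ := hg v hv
  simp only [Finsupp.coe_add, Pi.add_apply]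
  omega

/-- `(J^{(a)})^m ⊆ J^{(m·a)}`. -/
theorem symbPow_pow_le (a m : ℕ) : symbPow (k := k) a ^ m ≤ symbPow (m * a) := by
  induction m with
  | zero =>
    intro f _
    rw [zero_mul, mem_symbPow_iff]
    intro d _
    simp
  | succ m ih =>
    rw [pow_succ, Nat.succ_mul]
    exact le_trans (Ideal.mul_mono_left ih) (symbPow_mul_le (m * a) a)

/-- `X₃ = w ∈ J`. -/ theorem X3_mem_J : (X 3 : R k) ∈ J := Ideal.subset_span (by simp)
/-- `X₀X₁ ∈ J`. -/ theorem X01_mem_J : (X 0 * X 1 : R k) ∈ J := Ideal.subset_span (by simp)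
/-- `X₁X₂ ∈ J`. -/ theorem X12_mem_J : (X 1 * X 2 : R k) ∈ J := Ideal.subset_span (by simp)
/-- `X₀X₂ ∈ J`. -/ theorem X02_mem_J : (X 0 * X 2 : R k) ∈ J := Ideal.subset_span (by simp)

/-- `X_i X_j` as a monomial. -/
theorem X_mul_X_eq (i j : Fin 4) : (X i * X j : R k) = monomial (Finsupp.single i 1 + Finsupp.single j 1) 1 := by
  rw [X, X, monomial_mul, mul_one]

/-- `J ⊆ J^{(1)}`. -/
theorem J_le_symbPow_one : J (k := k) ≤ symbPow 1 := by
  rw [J, Ideal.span_le]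
  intro f hf
  simp only [Set.mem_insert_iff, Set.mem_singleton_iff] at hf
  rw [SetLike.mem_coe]
  rcases hf with rfl | rfl | rfl | rfl
  · have hX : (X 3 : R k) = monomial (Finsupp.single 3 1) 1 := rfl
    rw [hX]; exact monomial_mem_symbPow (by simp) (by simp) (by simp) 1
  · rw [X_mul_X_eq]; exact monomial_mem_symbPow (by simp) (by simp) (by simp) 1
  · rw [X_mul_X_eq]; exact monomial_mem_symbPow (by simp) (by simp) (by simp) 1
  · rw [X_mul_X_eq]; exact monomial_mem_symbPow (by simp) (by simp) (by simp) 1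

set_option linter.unnecessarySeqFocus false in -- uniform `<;>` chains over `fin_cases` (some branches close early)
/-- **`J^{(1)} = J`**: a monomial with the three inequalities at level `1` is divisible by `w` or by some `X_i X_j`. -/
theorem symbPow_one : symbPow (k := k) 1 = J := by
  classical
  refine le_antisymm (symbPow_le_of_monomial_mem fun d h1 h2 h3 => ?_) J_le_symbPow_one
  by_cases hw : 1 ≤ d 3
  · have hle : Finsupp.single (3 : Fin 4) 1 ≤ d := by
      intro l; fin_cases l <;> simp <;> omega
    rw [monomial_eq_mul_of_le hle]
    exact Ideal.mul_mem_right _ _ X3_mem_J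
  · have aux : ∀ i j : Fin 4, (X i * X j : R k) ∈ J → 1 ≤ d i → 1 ≤ d j → i ≠ j → monomial d (1 : k) ∈ J := by
      intro i j hgen hi hj hij
      have hle : Finsupp.single i 1 + Finsupp.single j 1 ≤ d := by
        intro t
        simp only [Finsupp.coe_add, Pi.add_apply, Finsupp.single_apply]
        split_ifs <;> subst_vars <;> omega
      rw [monomial_eq_mul_of_le hle, ← X_mul_X_eq]
      exact Ideal.mul_mem_right _ _ hgen
    by_cases h0 : d 0 = 0
    · exact aux 1 2 X12_mem_J (by omega) (by omega) (by decide)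
    · by_cases h1' : d 1 = 0
      · exact aux 0 2 X02_mem_J (by omega) (by omega) (by decide)
      · exact aux 0 1 X01_mem_J (by omega) (by omega) (by decide)

end ThreeLinesA4

end CampaignW36

end Summit.ResolutionOfSingularities.ResolutionOfSingularities.Theorems

end
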